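import Mathlib
import HarnessLib

/-!
# Eigen-matrices of the conjugation action of an irreducible rank-2 representation

Helper file for the item `EssSelfDualIrreducibleCM` (stmt-Langlands-13618) of the route
`IrreducibilityBySelfDuality`: for an IRREDUCIBLE `ρ : Γ → GL₂(k)` and a non-zero matrix `T` with
`ρ(g) T ρ(g)⁻¹ = χ(g) T` for all `g`:
* `T` is invertible (its kernel is a stable subspace) — `det_ne_zero_of_eigenmatrix`;
* if `χ = 1` and `k` is algebraically closed then `T` is scalar (Schur) — `exists_eq_smul_one_of_forall_conj_eq`;
  so a TRACE-ZERO such `T` has `χ ≠ 1` when `2 ≠ 0` — `exists_ne_one_of_eigenmatrix_of_trace_eq_zero`;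
* `χ² = 1` and `ρ(g)`, `χ(g) ρ(g)` have the same characteristic polynomial (`ρ ≅ ρ ⊗ χ`) —
  `sq_eq_one_of_eigenmatrix`, `charpoly_smul_eq_of_eigenmatrix`.
Pure linear algebra over a field `k` (Mathlib only).
-/

noncomputable section

set_option linter.dupNamespace false -- project-wide option (lakefile weak.linter.dupNamespace); `Summit.Langlands.Langlands` is the mandated namespace

open Matrix

namespace Summit.Langlands.Langlands.Theorems.EssSelfDualIrreducibleCM

variable {k : Type*} [Field k] {Γ : Type*} [Group Γ]

/-- An eigen-matrix `T ≠ 0` of the conjugations `ρ(g) · ρ(g)⁻¹` has non-zero eigenvalues, and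
`T ρ(g) = χ(g)⁻¹ ρ(g) T`. [folklore] -/
theorem mul_eq_of_eigenmatrix (ρ : Γ →* GL (Fin 2) k) {T : Matrix (Fin 2) (Fin 2) k} (hT : T ≠ 0)
    {χ : Γ → k} (h : ∀ g, (ρ g : Matrix (Fin 2) (Fin 2) k) * T * ((ρ g)⁻¹ : GL (Fin 2) k) = χ g • T)
    (g : Γ) : χ g ≠ 0 ∧ T * (ρ g : Matrix (Fin 2) (Fin 2) k) = (χ g)⁻¹ • ((ρ g : Matrix (Fin 2) (Fin 2) k) * T) := by
  have hPT : (ρ g : Matrix (Fin 2) (Fin 2) k) * T = χ g • (T * (ρ g : Matrix (Fin 2) (Fin 2) k)) := by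
    calc (ρ g : Matrix (Fin 2) (Fin 2) k) * T
        = (ρ g : Matrix (Fin 2) (Fin 2) k) * T * ((ρ g)⁻¹ : GL (Fin 2) k) * (ρ g : Matrix (Fin 2) (Fin 2) k) := by
          rw [Matrix.mul_assoc _ (((ρ g)⁻¹ : GL (Fin 2) k) : Matrix (Fin 2) (Fin 2) k), Units.inv_mul,
            Matrix.mul_one]
      _ = χ g • (T * (ρ g : Matrix (Fin 2) (Fin 2) k)) := by rw [h g, Matrix.smul_mul]
  have hχ : χ g ≠ 0 := by
    intro hg
    rw [hg, zero_smul] at hPT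
    apply hT
    calc T = (((ρ g)⁻¹ : GL (Fin 2) k) : Matrix (Fin 2) (Fin 2) k) * ((ρ g : Matrix (Fin 2) (Fin 2) k) * T) := by
          rw [← Matrix.mul_assoc, Units.inv_mul, Matrix.one_mul]
      _ = 0 := by rw [hPT, Matrix.mul_zero]
  refine ⟨hχ, ?_⟩
  rw [hPT, smul_smul, inv_mul_cancel₀ hχ, one_smul]

/-- **The kernel of an eigen-matrix is stable**: if `ρ : Γ → GL₂(k)` is irreducible (as a
representation on `k²`) and `T ≠ 0` satisfies `ρ(g) T ρ(g)⁻¹ = χ(g) T` for all `g`, then `T` is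
invertible — otherwise `ker T` is a `Γ`-stable line. [folklore] -/
theorem det_ne_zero_of_eigenmatrix (ρ : Γ →* GL (Fin 2) k)
    (hirr : Representation.IsIrreducible ((Representation.ofDistribMulAction k (GL (Fin 2) k) (Fin 2 → k)).comp ρ))
    {T : Matrix (Fin 2) (Fin 2) k} (hT : T ≠ 0) {χ : Γ → k}
    (h : ∀ g, (ρ g : Matrix (Fin 2) (Fin 2) k) * T * ((ρ g)⁻¹ : GL (Fin 2) k) = χ g • T) :
    T.det ≠ 0 := by
  classical
  set R := (Representation.ofDistribMulAction k (GL (Fin 2) k) (Fin 2 → k)).comp ρ with hR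
  have hRapply : ∀ (g : Γ) (v : Fin 2 → k), R g v = ((ρ g : GL (Fin 2) k) : Matrix (Fin 2) (Fin 2) k) *ᵥ v :=
    fun _ _ ↦ rfl
  intro hdet
  obtain ⟨v, hv0, hv⟩ := Matrix.exists_mulVec_eq_zero_iff.mpr hdet
  -- the stable subspace `ker T`
  let W : Subrepresentation R :=
    ⟨LinearMap.ker (Matrix.toLin' T), fun g u hu ↦ by
      rw [LinearMap.mem_ker, Matrix.toLin'_apply] at hu ⊢
      rw [hRapply, Matrix.mulVec_mulVec, (mul_eq_of_eigenmatrix ρ hT h g).2, Matrix.smul_mulVec,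
        ← Matrix.mulVec_mulVec, hu, Matrix.mulVec_zero, smul_zero]⟩
  have hW : ∀ u, u ∈ W.toSubmodule ↔ T *ᵥ u = 0 := fun u ↦ by
    change u ∈ LinearMap.ker (Matrix.toLin' T) ↔ _
    rw [LinearMap.mem_ker, Matrix.toLin'_apply]
  rcases hirr.eq_bot_or_eq_top W with hW' | hW'
  · have : v ∈ W.toSubmodule := (hW v).mpr hv
    rw [hW'] at this
    exact hv0 ((Submodule.mem_bot k).mp this)
  · apply hT
    ext i j
    have hj : (Pi.single j 1 : Fin 2 → k) ∈ W.toSubmodule := by rw [hW']; trivial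
    have := congr_fun ((hW _).mp hj) i
    rwa [Matrix.mulVec_single_one] at this

/-- **Schur's lemma for the conjugation action**: if `ρ : Γ → GL₂(k)` is irreducible over an
algebraically closed field `k` and `T` commutes with every `ρ(g)` (`ρ(g) T ρ(g)⁻¹ = T`), then `T`
is a scalar matrix (`T - c` is a singular eigen-matrix for an eigenvalue `c` of `T`, hence zero by
`det_ne_zero_of_eigenmatrix`). [folklore] -/
theorem exists_eq_smul_one_of_forall_conj_eq [IsAlgClosed k] (ρ : Γ →* GL (Fin 2) k)
    (hirr : Representation.IsIrreducible ((Representation.ofDistribMulAction k (GL (Fin 2) k) (Fin 2 → k)).comp ρ))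
    {T : Matrix (Fin 2) (Fin 2) k}
    (h : ∀ g, (ρ g : Matrix (Fin 2) (Fin 2) k) * T * ((ρ g)⁻¹ : GL (Fin 2) k) = T) :
    ∃ c : k, T = c • (1 : Matrix (Fin 2) (Fin 2) k) := by
  classical
  obtain ⟨c, hc⟩ := Module.End.exists_eigenvalue (Matrix.toLin' T)
  obtain ⟨v, hv⟩ := hc.exists_hasEigenvector
  have hv0 : v ≠ 0 := hv.2
  have hTv : T *ᵥ v = c • v := by rw [← Matrix.toLin'_apply]; exact Module.End.mem_eigenspace_iff.mp hv.1
  refine ⟨c, ?_⟩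
  -- `T' = T - c` is a singular eigen-matrix (eigenvalue `1`)
  set T' : Matrix (Fin 2) (Fin 2) k := T - c • (1 : Matrix (Fin 2) (Fin 2) k) with hT'
  have hT'v : T' *ᵥ v = 0 := by
    rw [hT', Matrix.sub_mulVec, Matrix.smul_mulVec, Matrix.one_mulVec, hTv, sub_self]
  have hdet : T'.det = 0 := Matrix.exists_mulVec_eq_zero_iff.mp ⟨v, hv0, hT'v⟩
  have h' : ∀ g, (ρ g : Matrix (Fin 2) (Fin 2) k) * T' * ((ρ g)⁻¹ : GL (Fin 2) k) = (fun _ ↦ (1 : k)) g • T' :=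
    fun g ↦ by
      rw [one_smul, hT', Matrix.mul_sub, Matrix.sub_mul, h g, Matrix.mul_smul, Matrix.mul_one,
        Matrix.smul_mul, Units.mul_inv]
  by_contra hne
  have hT'0 : T' ≠ 0 := fun h0 ↦ hne (sub_eq_zero.mp (hT' ▸ h0))
  exact det_ne_zero_of_eigenmatrix ρ hirr hT'0 h' hdet

/-- A **trace-zero** eigen-matrix of an irreducible `ρ : Γ → GL₂(k)` (`k` algebraically closed,
`2 ≠ 0`) has a non-trivial eigencharacter: if `ρ(g) T ρ(g)⁻¹ = χ(g) T` for all `g` with `T ≠ 0`,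
`tr T = 0`, then `χ(g) ≠ 1` for some `g` (else `T` is scalar with trace `2c = 0`, so `T = 0`).
[folklore] -/
theorem exists_ne_one_of_eigenmatrix_of_trace_eq_zero [IsAlgClosed k] (h2 : (2 : k) ≠ 0)
    (ρ : Γ →* GL (Fin 2) k)
    (hirr : Representation.IsIrreducible ((Representation.ofDistribMulAction k (GL (Fin 2) k) (Fin 2 → k)).comp ρ))
    {T : Matrix (Fin 2) (Fin 2) k} (hT : T ≠ 0) (htr : T.trace = 0) {χ : Γ → k}
    (h : ∀ g, (ρ g : Matrix (Fin 2) (Fin 2) k) * T * ((ρ g)⁻¹ : GL (Fin 2) k) = χ g • T) :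
    ∃ g, χ g ≠ 1 := by
  by_contra hall
  push Not at hall
  obtain ⟨c, hc⟩ := exists_eq_smul_one_of_forall_conj_eq ρ hirr (T := T) fun g ↦ by
    rw [h g, hall g, one_smul]
  rw [hc, Matrix.trace_smul, Matrix.trace_one, Fintype.card_fin, smul_eq_mul] at htr
  have hc0 : c = 0 := by
    rcases mul_eq_zero.mp htr with h0 | h0
    · exact h0
    · exact absurd (by exact_mod_cast h0) h2
  exact hT (by rw [hc, hc0, zero_smul])

/-- For an INVERTIBLE eigen-matrix, `det (ρ(g) T ρ(g)⁻¹) = det T = χ(g)² det T` gives `χ(g)² = 1`.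
[folklore] -/
theorem sq_eq_one_of_eigenmatrix (ρ : Γ →* GL (Fin 2) k) {T : Matrix (Fin 2) (Fin 2) k}
    (hdet : T.det ≠ 0) {χ : Γ → k}
    (h : ∀ g, (ρ g : Matrix (Fin 2) (Fin 2) k) * T * ((ρ g)⁻¹ : GL (Fin 2) k) = χ g • T) (g : Γ) :
    χ g ^ 2 = 1 := by
  have h1 := congrArg Matrix.det (h g)
  rw [Matrix.det_units_conj, Matrix.det_smul, Fintype.card_fin] at h1
  have : (χ g ^ 2 - 1) * T.det = 0 := by linear_combination -h1
  exact sub_eq_zero.mp ((mul_eq_zero.mp this).resolve_right hdet)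

/-- For an INVERTIBLE eigen-matrix, `χ(g) ρ(g) = T⁻¹ ρ(g) T` is conjugate to `ρ(g)`, so `ρ(g)` and
`χ(g) ρ(g)` have the same characteristic polynomial (`ρ ≅ ρ ⊗ χ`). [folklore] -/
theorem charpoly_smul_eq_of_eigenmatrix (ρ : Γ →* GL (Fin 2) k) {T : Matrix (Fin 2) (Fin 2) k}
    (hT : T ≠ 0) (hdet : T.det ≠ 0) {χ : Γ → k}
    (h : ∀ g, (ρ g : Matrix (Fin 2) (Fin 2) k) * T * ((ρ g)⁻¹ : GL (Fin 2) k) = χ g • T) (g : Γ) :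
    (χ g • (ρ g : Matrix (Fin 2) (Fin 2) k)).charpoly = (ρ g : Matrix (Fin 2) (Fin 2) k).charpoly := by
  classical
  obtain ⟨U, hU⟩ : IsUnit T := (Matrix.isUnit_iff_isUnit_det T).mpr (isUnit_iff_ne_zero.mpr hdet)
  obtain ⟨hχ, hTP⟩ := mul_eq_of_eigenmatrix ρ hT h g
  -- `ρ(g) T = χ(g) T ρ(g)` gives `T⁻¹ ρ(g) T = χ(g) ρ(g)`
  have key : ((U⁻¹ : (Matrix (Fin 2) (Fin 2) k)ˣ) : Matrix (Fin 2) (Fin 2) k) * (ρ g : Matrix (Fin 2) (Fin 2) k) * U =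
      χ g • (ρ g : Matrix (Fin 2) (Fin 2) k) := by
    have hPT : (ρ g : Matrix (Fin 2) (Fin 2) k) * T = χ g • (T * (ρ g : Matrix (Fin 2) (Fin 2) k)) := by
      rw [hTP, smul_smul, mul_inv_cancel₀ hχ, one_smul]
    rw [Matrix.mul_assoc, hU, hPT, ← hU, Matrix.mul_smul, ← Matrix.mul_assoc, Units.inv_mul, Matrix.one_mul]
  rw [← key, Matrix.coe_units_inv]
  exact Matrix.charpoly_units_conj' U _

end Summit.Langlands.Langlands.Theorems.EssSelfDualIrreducibleCM

end
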